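import Summits.QuantumFields.BalabanUV.Beta.GAN24.DerivativeRateTransferAnalytic
import Literature.Analysis.Complex.OsgoodProofs

/-!
# `BalabanUV.Beta.GAN24.DerivativeRateTransferAnalyticMixed` — binder row G-an2-4 ∕ (CONV-C), route R6 «VALUES, NOT DERIVATIVES», PART 8:
# THE MIXED SECOND-ORDER ANALYTIC TRANSFER — a VALUE-LEVEL rate on the REAL background SQUARE `[0,s₁]²` + JOINT holomorphy with ONE
# uniform bound on the BIDISC ⇒ the MIXED derivative `∂_t∂_s F(0,0)` at the base point inherits the rate with exponent
# `(θ^{1−r})^{1−r′}` for EVERY `r, r′ ∈ ]0, 1]` — the polarised second-order u-rows `K_{uu′}`, `Q_{uu′}` (`u ≠ u′`) of the two-bond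
# family that PART 7 («MIXED derivatives `∂_s∂_t` (two complex parameters) — not typed in v1») left open; engine = PART 7's
# `deriv_step_rateω` applied TWICE, the holomorphy of `t ↦ ∂_sF(0,t)` by OSGOOD's lemma (`Literature.Analysis.Complex.OsgoodProofs`,
# Hörmander Thm 2.2.1∕2.2.6 — the tree's Literature theorem, BY NAME) (unit b2b-balaban-gan24-p3, gen 34; v1)

NOT IN PRINT; OUR PROOF (for the ROUTE; [folklore] complex analysis — PART 7's `deriv_step_rateω` (over beta-d4-p3's
`RemainderExplicitMarkovRate.norm_deriv_le_of_segment` p308106 ✓) and `norm_deriv_le_inner` (Cauchy) BY NAME; Osgood's lemma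
`Literature.Analysis.Complex.SCV.analyticOnNhd_of_differentiableOn` + Mathlib's `AnalyticOnNhd.fderiv` BY NAME; the chain rule).  HONEST
FRAMING (cell contract, verbatim): «discharging `BetaPertH` makes Bałaban's UV stability UNCONDITIONAL — a real constructive-QFT result; it is NOT the
continuum limit and NOT the Clay problem.»  HONEST DEPENDENCY (verbatim): «continuum YM on T⁴ ⇐ BetaPertH ∧ nine spine estimates (0/9 proved); BetaPertH ⇐
(D1) ∧ (D4) ∧ CAP+tail; G-an2-4 gates asym, D1 and NE2/3/4.»

WHY THIS FILE.  ROUTES-GAN24 §2 R6 reads the u-derivative constituents of (CONV-C) as Taylor coefficients at `B = 0` of VALUE-level blocks of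
`M_k(B)` along the TWO-bond background family `B(s,t) = s·e_b + t·e_{b′}`: `K_u = ∂_sK_k(B(s,0))|₀`, `K_{uu′} = ∂_s∂_tK_k(B(s,t))|₀` (polarisation),
and likewise `Q_u`, `Q_{uu′}` (AN1 §4, T1–T8).  PART 7 made the transfer step S4′ kernel for ONE complex parameter: first order
(`deriv_step_rateω`, exponent `θ^{1−r}`) and PURE second order by iteration (`deriv₂_step_rateω`, `(θ^{1−r})^{1−r}`) — which covers the
diagonal pairs `b = b′`; its docstring lists «MIXED derivatives `∂_s∂_t` (two complex parameters — not typed in v1)» as NOT done.  The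
polarised rows with `b ≠ b′` are MIXED derivatives of a function of TWO complex variables.  THIS FILE types them: for entry families
`F k : ℂ × ℂ → ℂ` JOINTLY holomorphic on the bidisc `ball 0 ρ ×ˢ ball 0 ρ` with `‖F k‖ ≤ B` there and a value rate `c·θ^k` on the real
square `[0,s₁]²` (`s₁·cosh 1 < ρ`; ONE-SIDED in both variables suffices), the mixed-derivative row at the base point is geometric with exponent
`(θ^{1−r})^{1−r′}`, every `r, r′ ∈ ]0,1]` (e.g. `θ^{1∕4}` at `r = r′ = ½`; `θ^{(1−r)²} → θ` as `r → 0` at the price of the constant).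
The ONE analytic input beyond PART 7 is that `t ↦ ∂_sF(0,t)` is holomorphic on the disc — Osgood's lemma (joint holomorphy ⇒ analytic ⇒
`fderiv` analytic), the tree's `Literature.Analysis.Complex.OsgoodProofs` (Hörmander Thm 2.2.1∕2.2.6, PROVED there) BY NAME.

WHAT THIS FILE PROVES (0 sorry, 0 `def`):
* §1 [folklore] SLICES of a jointly holomorphic `f : ℂ × ℂ → ℂ` on the bidisc: `differentiableOn_slice_fst` (each `s`-slice is holomorphic),
  `hasDerivAt_slice_fst` ∕ `deriv_slice_fst` (`∂_s f(s,t) = Df(s,t)·(1,0)`), **`differentiableOn_dslice`** (`t ↦ ∂_sf(0,t)` is holomorphic on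
  `ball 0 ρ` — Osgood + `AnalyticOnNhd.fderiv` + chain rule), `norm_dslice_le` (Cauchy: `‖∂_sf(0,t)‖ ≤ 4B∕ρ` on the disc), `real_mem_ball`;
* §2 the MIXED TRANSFER: `dslice_step_rate` (at each real `t ∈ [0,s₁]` the `s`-derivative row inherits the value rate — PART 7's
  `deriv_step_rateω` on the slice), **`derivMixed_step_rateω`** (`‖∂_t∂_sF_{k+1}(0,0) − ∂_t∂_sF_k(0,0)‖ ≤ C(B,ρ,s₁,c,r,r′)·((θ^{1−r})^{1−r′})^k`
  — `deriv_step_rateω` AGAIN on the holomorphic family `t ↦ ∂_sF_k(0,t)`, bound `4B∕ρ`, rate from `dslice_step_rate`), and the ∃θ-currency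
  END **`exists_derivMixed_geometricRate`**;
* §3 the SYMMETRIC companion `derivMixed_step_rateω_swap` (`∂_s∂_t`, by the swap `(s,t) ↦ (t,s)` of the bidisc), the first-order rows of
  the two-bond family `deriv_fst_step_rateω` ∕ `deriv_snd_step_rateω` (PART 7 on the two slices through the base point), and the JOINT END
  `exists_secondOrderJet_geometricRate`: ONE pair `(c″, θ″)`, `θ″ < 1`, bounding FOUR rows at once — the two first-order rows `∂_s`, `∂_t` and
  the two mixed rows `∂_t∂_s`, `∂_s∂_t` of the family at the base point (the pure rows `∂_s²`, `∂_t²` are PART 7 §4 on the slices).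
WHAT IT DOES NOT DO: supply S1 (the value rate WITH BACKGROUND, uniformly on the real square — the route's one open input, = NE2-P2's
with-background END), S2 (the Bałaban-instance dictionary: joint analyticity + the uniform bound `B` on a complex bidisc — the printed KIND of
input is [Balaban1985BackgroundPropagators] Thm 3.4, CONTEXT only, nothing printed is used), the decay clause (PART 4's `decay_interp` pattern
applies verbatim), or any instantiation on Bałaban's objects.  SUPPLIER work on route R6 (rank 2, «KEEP-AS-REDUCTION», no seat); no consumer of
record; NOT one of the nine spine estimates; NEVER «G-an2-4 closed»; NOT (CONV-C), NOT D1, NOT `BetaPertH`, NOT continuum, NOT Clay.  Records: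
`HOME/b2b-balaban-gan24-p3/WOODBURY-FIBRE.md` v13.4, `HOME/beta/ROUTES-GAN24.md` v26∕v27 «R6 — v26∕v27 NOTE» (gan24-idea-1 g27∕g28, whose
polydisc remark «mixed `∂_s∂_t` … by iterating (real `t` first …; then in `t`)» this file executes, with credit).
-/

noncomputable section
open Set Metric

namespace Summit.QuantumFields.BalabanUV.Beta.GAN24.DerivativeRateTransferAnalyticMixed

open Summit.QuantumFields.BalabanUV.Beta.GAN24.DerivativeRateTransferAnalytic
  (rho_pos deriv_step_rateω norm_deriv_le_inner rpow_geom)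

/-! ## §1 Slices of a jointly holomorphic function of two complex variables on the bidisc -/

section Slices

variable {f : ℂ × ℂ → ℂ} {ρ : ℝ}

/-- [folklore] the bidisc `ball 0 ρ ×ˢ ball 0 ρ ⊆ ℂ × ℂ` is open. -/
theorem isOpen_bidisc : IsOpen (ball (0 : ℂ) ρ ×ˢ ball (0 : ℂ) ρ) := isOpen_ball.prod isOpen_ball

/-- [folklore] a real parameter `t ∈ [0, s₁]` with `s₁·cosh 1 < ρ` lies in the disc `ball 0 ρ` (as a complex number). -/
theorem real_mem_ball {s₁ t : ℝ} (hs₁ : 0 < s₁) (hs₁ρ : s₁ * Real.cosh 1 < ρ) (ht0 : 0 ≤ t) (ht : t ≤ s₁) :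
    (t : ℂ) ∈ ball (0 : ℂ) ρ := by
  rw [mem_ball_zero_iff, Complex.norm_real, Real.norm_eq_abs, abs_of_nonneg ht0]
  have : s₁ ≤ s₁ * Real.cosh 1 := le_mul_of_one_le_right hs₁.le (Real.one_le_cosh 1)
  linarith

/-- [folklore] each `s`-SLICE `s ↦ f (s, t)` (`t ∈ ball 0 ρ`) of a function holomorphic on the bidisc is holomorphic on `ball 0 ρ`. -/
theorem differentiableOn_slice_fst (hf : DifferentiableOn ℂ f (ball (0 : ℂ) ρ ×ˢ ball (0 : ℂ) ρ)) {t : ℂ}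
    (ht : t ∈ ball (0 : ℂ) ρ) : DifferentiableOn ℂ (fun s : ℂ => f (s, t)) (ball (0 : ℂ) ρ) :=
  hf.comp (differentiableOn_id.prodMk (differentiableOn_const t)) fun _ hs => ⟨hs, ht⟩

/-- [folklore] each `t`-SLICE `t ↦ f (s, t)` (`s ∈ ball 0 ρ`) of a function holomorphic on the bidisc is holomorphic on `ball 0 ρ`. -/
theorem differentiableOn_slice_snd (hf : DifferentiableOn ℂ f (ball (0 : ℂ) ρ ×ˢ ball (0 : ℂ) ρ)) {s : ℂ}
    (hs : s ∈ ball (0 : ℂ) ρ) : DifferentiableOn ℂ (fun t : ℂ => f (s, t)) (ball (0 : ℂ) ρ) :=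
  hf.comp ((differentiableOn_const s).prodMk differentiableOn_id) fun _ ht => ⟨hs, ht⟩

/-- [folklore] CHAIN RULE for the `s`-slice: at a point of the bidisc, `∂_s f(s,t) = Df(s,t)·(1,0)`. -/
theorem hasDerivAt_slice_fst (hf : DifferentiableOn ℂ f (ball (0 : ℂ) ρ ×ˢ ball (0 : ℂ) ρ)) {s t : ℂ}
    (hs : s ∈ ball (0 : ℂ) ρ) (ht : t ∈ ball (0 : ℂ) ρ) :
    HasDerivAt (fun s : ℂ => f (s, t)) (fderiv ℂ f (s, t) (1, 0)) s := by
  have hmem : ball (0 : ℂ) ρ ×ˢ ball (0 : ℂ) ρ ∈ nhds (s, t) := isOpen_bidisc.mem_nhds ⟨hs, ht⟩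
  have hF : HasFDerivAt f (fderiv ℂ f (s, t)) (s, t) := (hf.differentiableAt hmem).hasFDerivAt
  have hι : HasDerivAt (fun s : ℂ => (s, t)) (1, 0) s := (hasDerivAt_id s).prodMk (hasDerivAt_const s t)
  have key := hF.comp_hasDerivAt s hι
  simpa [Function.comp_def] using key

/-- [folklore] `deriv` form of `hasDerivAt_slice_fst`. -/
theorem deriv_slice_fst (hf : DifferentiableOn ℂ f (ball (0 : ℂ) ρ ×ˢ ball (0 : ℂ) ρ)) {s t : ℂ}
    (hs : s ∈ ball (0 : ℂ) ρ) (ht : t ∈ ball (0 : ℂ) ρ) :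
    deriv (fun s : ℂ => f (s, t)) s = fderiv ℂ f (s, t) (1, 0) :=
  (hasDerivAt_slice_fst hf hs ht).deriv

/-- **`differentiableOn_dslice` — THE `s`-DERIVATIVE AT THE BASE POINT IS HOLOMORPHIC IN `t`** [folklore; Osgood BY NAME]: `f` holomorphic on the
bidisc, `0 < ρ` ⇒ `t ↦ ∂_s f(0,t)` is holomorphic on `ball 0 ρ`.  Proof: `f` is analytic on the (open) bidisc by Osgood's lemma
(`Literature.Analysis.Complex.SCV.analyticOnNhd_of_differentiableOn`), hence `fderiv ℂ f` is analytic there (`AnalyticOnNhd.fderiv`), hence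
`t ↦ Df(0,t)·(1,0)` is holomorphic; and `∂_s f(0,t) = Df(0,t)·(1,0)` (`deriv_slice_fst`). -/
theorem differentiableOn_dslice (hf : DifferentiableOn ℂ f (ball (0 : ℂ) ρ ×ˢ ball (0 : ℂ) ρ)) (hρ : 0 < ρ) :
    DifferentiableOn ℂ (fun t : ℂ => deriv (fun s : ℂ => f (s, t)) 0) (ball (0 : ℂ) ρ) := by
  have hA : AnalyticOnNhd ℂ f (ball (0 : ℂ) ρ ×ˢ ball (0 : ℂ) ρ) :=
    Literature.Analysis.Complex.SCV.analyticOnNhd_of_differentiableOn hf isOpen_bidisc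
  have hD : DifferentiableOn ℂ (fderiv ℂ f) (ball (0 : ℂ) ρ ×ˢ ball (0 : ℂ) ρ) := hA.fderiv.differentiableOn
  have h1 : DifferentiableOn ℂ (fun t : ℂ => fderiv ℂ f (0, t)) (ball (0 : ℂ) ρ) :=
    hD.comp ((differentiableOn_const (0 : ℂ)).prodMk differentiableOn_id) fun _ ht => ⟨mem_ball_self hρ, ht⟩
  have h2 : DifferentiableOn ℂ (fun t : ℂ => fderiv ℂ f (0, t) (1, 0)) (ball (0 : ℂ) ρ) :=
    h1.clm_apply (differentiableOn_const _)
  exact h2.congr fun t ht => deriv_slice_fst hf (mem_ball_self hρ) ht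

/-- **`norm_dslice_le` — CAUCHY BOUND FOR THE `s`-DERIVATIVE AT THE BASE POINT, UNIFORM IN `t`** [folklore]: `f` holomorphic on the bidisc with
`‖f‖ ≤ B` there, `0 < ρ` ⇒ for every `t ∈ ball 0 ρ`, `‖∂_s f(0,t)‖ ≤ 4B∕ρ` (PART 7's `norm_deriv_le_inner` on the slice, inner radius `ρ∕2`). -/
theorem norm_dslice_le (hf : DifferentiableOn ℂ f (ball (0 : ℂ) ρ ×ˢ ball (0 : ℂ) ρ))
    {B : ℝ} (hB : ∀ p ∈ ball (0 : ℂ) ρ ×ˢ ball (0 : ℂ) ρ, ‖f p‖ ≤ B) (hρ : 0 < ρ) {t : ℂ} (ht : t ∈ ball (0 : ℂ) ρ) :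
    ‖deriv (fun s : ℂ => f (s, t)) 0‖ ≤ 4 * B / ρ := by
  have hg : DifferentiableOn ℂ (fun s : ℂ => f (s, t)) (ball (0 : ℂ) ρ) := differentiableOn_slice_fst hf ht
  have hgB : ∀ z ∈ ball (0 : ℂ) ρ, ‖(fun s : ℂ => f (s, t)) z‖ ≤ B := fun z hz => hB (z, t) ⟨hz, ht⟩
  have key := norm_deriv_le_inner hg hgB (ρ₁ := ρ / 2) (by linarith) (z := 0) (mem_ball_self (by linarith))
  calc ‖deriv (fun s : ℂ => f (s, t)) 0‖ ≤ 2 * B / (ρ - ρ / 2) := key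
    _ = 4 * B / ρ := by field_simp; ring

end Slices

/-! ## §2 The mixed transfer: PART 7's `deriv_step_rateω` on the `s`-slices at real `t`, then AGAIN on the holomorphic family `t ↦ ∂_sF_k(0,t)` -/

section Mixed

variable {F : ℕ → ℂ × ℂ → ℂ} {ρ s₁ B c θ : ℝ}

/-- **`dslice_step_rate` — AT EACH REAL `t ∈ [0,s₁]` THE `s`-DERIVATIVE ROW INHERITS THE VALUE RATE** [our proof; PART 7 BY NAME]: `F k` jointly
holomorphic on the bidisc with `‖F k‖ ≤ B`, value rate `‖F (k+1) (s,t) − F k (s,t)‖ ≤ c·θ^k` on the real square `[0,s₁]²`, `0 < c`, `0 < θ`,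
`0 < s₁`, `s₁·cosh 1 < ρ`: for every `r ∈ ]0,1]`, every `k` and every real `t ∈ [0,s₁]`,
`‖∂_sF_{k+1}(0,t) − ∂_sF_k(0,t)‖ ≤ 25·(2B)^r∕(s₁r²) · c^{1−r} · (θ^{1−r})^k`. -/
theorem dslice_step_rate (hs₁ : 0 < s₁) (hs₁ρ : s₁ * Real.cosh 1 < ρ)
    (hF : ∀ k, DifferentiableOn ℂ (F k) (ball (0 : ℂ) ρ ×ˢ ball (0 : ℂ) ρ))
    (hB : ∀ k, ∀ p ∈ ball (0 : ℂ) ρ ×ˢ ball (0 : ℂ) ρ, ‖F k p‖ ≤ B)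
    (hrate : ∀ k (s t : ℝ), 0 ≤ s → s ≤ s₁ → 0 ≤ t → t ≤ s₁ →
      ‖F (k + 1) ((s : ℂ), (t : ℂ)) - F k ((s : ℂ), (t : ℂ))‖ ≤ c * θ ^ k)
    (hc : 0 < c) (hθ : 0 < θ) {r : ℝ} (hr : 0 < r) (hr1 : r ≤ 1) (k : ℕ) {t : ℝ} (ht0 : 0 ≤ t) (ht : t ≤ s₁) :
    ‖deriv (fun s : ℂ => F (k + 1) (s, (t : ℂ))) 0 - deriv (fun s : ℂ => F k (s, (t : ℂ))) 0‖ ≤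
      25 * (2 * B) ^ r / (s₁ * r ^ 2) * c ^ (1 - r) * (θ ^ (1 - r)) ^ k := by
  have htC : (t : ℂ) ∈ ball (0 : ℂ) ρ := real_mem_ball hs₁ hs₁ρ ht0 ht
  exact deriv_step_rateω (F := fun k s => F k (s, (t : ℂ))) hs₁ hs₁ρ
    (fun k => differentiableOn_slice_fst (hF k) htC) (fun k z hz => hB k (z, (t : ℂ)) ⟨hz, htC⟩)
    (fun k s hs0 hs1 => hrate k s t hs0 hs1 ht0 ht) hc hθ hr hr1 k

/-- [folklore] the first-order rate constant `25·(2B)^r∕(s₁r²)·c^{1−r}` is positive when `0 < B`, `0 < c`, `0 < s₁`, `0 < r`. -/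
theorem const₁_pos (hs₁ : 0 < s₁) (hB0 : 0 < B) (hc : 0 < c) {r : ℝ} (hr : 0 < r) :
    0 < 25 * (2 * B) ^ r / (s₁ * r ^ 2) * c ^ (1 - r) := by
  have : 0 < (2 * B) ^ r := Real.rpow_pos_of_pos (by linarith) r
  have : 0 < c ^ (1 - r) := Real.rpow_pos_of_pos hc _
  positivity

/-- **`derivMixed_step_rateω` — THE MIXED-DERIVATIVE ROW INHERITS THE VALUE RATE WITH EXPONENT `(θ^{1−r})^{1−r′}`** [our proof]: `F k` jointly
holomorphic on the bidisc `ball 0 ρ ×ˢ ball 0 ρ` with `‖F k‖ ≤ B` (`0 < B`), value rate `c·θ^k` on the real square `[0,s₁]²` (`0 < c`, `0 < θ`,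
`0 < s₁`, `s₁·cosh 1 < ρ`): for all `r, r′ ∈ ]0,1]` and every `k`,
`‖∂_t∂_sF_{k+1}(0,0) − ∂_t∂_sF_k(0,0)‖ ≤ 25·(2·(4B∕ρ))^{r′}∕(s₁r′²) · (25·(2B)^r∕(s₁r²)·c^{1−r})^{1−r′} · ((θ^{1−r})^{1−r′})^k`
— PART 7's `deriv_step_rateω` applied to the family `t ↦ ∂_sF_k(0,t)` (holomorphic by `differentiableOn_dslice`, bounded by `4B∕ρ` by
`norm_dslice_le`, with the rate `dslice_step_rate` on the real `t`-segment). Here `∂_t∂_sF(0,0) := deriv (t ↦ deriv (s ↦ F (s,t)) 0) 0`. -/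
theorem derivMixed_step_rateω (hs₁ : 0 < s₁) (hs₁ρ : s₁ * Real.cosh 1 < ρ)
    (hF : ∀ k, DifferentiableOn ℂ (F k) (ball (0 : ℂ) ρ ×ˢ ball (0 : ℂ) ρ))
    (hB : ∀ k, ∀ p ∈ ball (0 : ℂ) ρ ×ˢ ball (0 : ℂ) ρ, ‖F k p‖ ≤ B) (hB0 : 0 < B)
    (hrate : ∀ k (s t : ℝ), 0 ≤ s → s ≤ s₁ → 0 ≤ t → t ≤ s₁ →
      ‖F (k + 1) ((s : ℂ), (t : ℂ)) - F k ((s : ℂ), (t : ℂ))‖ ≤ c * θ ^ k)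
    (hc : 0 < c) (hθ : 0 < θ) {r r' : ℝ} (hr : 0 < r) (hr1 : r ≤ 1) (hr' : 0 < r') (hr'1 : r' ≤ 1) (k : ℕ) :
    ‖deriv (fun t : ℂ => deriv (fun s : ℂ => F (k + 1) (s, t)) 0) 0
        - deriv (fun t : ℂ => deriv (fun s : ℂ => F k (s, t)) 0) 0‖ ≤
      25 * (2 * (4 * B / ρ)) ^ r' / (s₁ * r' ^ 2) * (25 * (2 * B) ^ r / (s₁ * r ^ 2) * c ^ (1 - r)) ^ (1 - r')
        * ((θ ^ (1 - r)) ^ (1 - r')) ^ k := by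
  have hρ : 0 < ρ := rho_pos hs₁ hs₁ρ
  exact deriv_step_rateω (F := fun k t => deriv (fun s : ℂ => F k (s, t)) 0) hs₁ hs₁ρ
    (fun k => differentiableOn_dslice (hF k) hρ) (fun k z hz => norm_dslice_le (hF k) (hB k) hρ hz)
    (fun k t ht0 ht1 => dslice_step_rate hs₁ hs₁ρ hF hB hrate hc hθ hr hr1 k ht0 ht1)
    (const₁_pos hs₁ hB0 hc hr) (Real.rpow_pos_of_pos hθ _) hr' hr'1 k

/-- **`exists_derivMixed_geometricRate` — THE ∃θ-CURRENCY END FOR THE MIXED ROW** [our proof]: under the hypotheses of `derivMixed_step_rateω`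
(with `θ < 1`), `∃ c″ θ″, 0 ≤ c″ ∧ 0 ≤ θ″ ∧ θ″ < 1 ∧ ∀ k, ‖∂_t∂_sF_{k+1}(0,0) − ∂_t∂_sF_k(0,0)‖ ≤ c″·θ″^k` (witness
`θ″ = (θ^{1∕2})^{1∕2}` from `r = r′ = ½`; any `(θ^{1−r})^{1−r′}` is available from `derivMixed_step_rateω`). -/
theorem exists_derivMixed_geometricRate (hs₁ : 0 < s₁) (hs₁ρ : s₁ * Real.cosh 1 < ρ)
    (hF : ∀ k, DifferentiableOn ℂ (F k) (ball (0 : ℂ) ρ ×ˢ ball (0 : ℂ) ρ))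
    (hB : ∀ k, ∀ p ∈ ball (0 : ℂ) ρ ×ˢ ball (0 : ℂ) ρ, ‖F k p‖ ≤ B) (hB0 : 0 < B)
    (hrate : ∀ k (s t : ℝ), 0 ≤ s → s ≤ s₁ → 0 ≤ t → t ≤ s₁ →
      ‖F (k + 1) ((s : ℂ), (t : ℂ)) - F k ((s : ℂ), (t : ℂ))‖ ≤ c * θ ^ k)
    (hc : 0 < c) (hθ : 0 < θ) (hθ1 : θ < 1) :
    ∃ c'' θ'' : ℝ, 0 ≤ c'' ∧ 0 ≤ θ'' ∧ θ'' < 1 ∧ ∀ k,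
      ‖deriv (fun t : ℂ => deriv (fun s : ℂ => F (k + 1) (s, t)) 0) 0
          - deriv (fun t : ℂ => deriv (fun s : ℂ => F k (s, t)) 0) 0‖ ≤ c'' * θ'' ^ k := by
  have hρ : 0 < ρ := rho_pos hs₁ hs₁ρ
  refine ⟨_, (θ ^ (1 - 1 / 2 : ℝ)) ^ (1 - 1 / 2 : ℝ), ?_, ?_, ?_,
    fun k => derivMixed_step_rateω hs₁ hs₁ρ hF hB hB0 hrate hc hθ (r := 1 / 2) (r' := 1 / 2)
      (by norm_num) (by norm_num) (by norm_num) (by norm_num) k⟩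
  · have h1 : 0 ≤ (2 * (4 * B / ρ)) ^ (1 / 2 : ℝ) := Real.rpow_nonneg (by positivity) _
    have h2 : 0 ≤ (25 * (2 * B) ^ (1 / 2 : ℝ) / (s₁ * (1 / 2 : ℝ) ^ 2) * c ^ (1 - 1 / 2 : ℝ)) ^ (1 - 1 / 2 : ℝ) :=
      Real.rpow_nonneg (const₁_pos hs₁ hB0 hc (by norm_num : (0 : ℝ) < 1 / 2)).le _
    positivity
  · exact Real.rpow_nonneg (Real.rpow_nonneg hθ.le _) _
  · have h1 : θ ^ (1 - 1 / 2 : ℝ) < 1 := Real.rpow_lt_one hθ.le hθ1 (by norm_num)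
    exact Real.rpow_lt_one (Real.rpow_nonneg hθ.le _) h1 (by norm_num)

end Mixed

/-! ## §3 The swapped row `∂_s∂_t` and the joint ∃θ END for the first-order and mixed rows of the two-bond family -/

section Joint

variable {F : ℕ → ℂ × ℂ → ℂ} {ρ s₁ B c θ : ℝ}

/-- [folklore] the SWAP `(s,t) ↦ (t,s)` preserves the bidisc and joint holomorphy. -/
theorem differentiableOn_swap {f : ℂ × ℂ → ℂ} (hf : DifferentiableOn ℂ f (ball (0 : ℂ) ρ ×ˢ ball (0 : ℂ) ρ)) :
    DifferentiableOn ℂ (fun p : ℂ × ℂ => f (p.2, p.1)) (ball (0 : ℂ) ρ ×ˢ ball (0 : ℂ) ρ) :=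
  hf.comp (differentiableOn_snd.prodMk differentiableOn_fst) fun _ hp => ⟨hp.2, hp.1⟩

/-- **`derivMixed_step_rateω_swap` — THE OTHER MIXED ROW `∂_s∂_tF(0,0)`** [our proof]: the same bound for
`deriv (s ↦ deriv (t ↦ F k (s,t)) 0) 0`, by `derivMixed_step_rateω` applied to the swapped family `(s,t) ↦ F k (t,s)` (the hypotheses are
symmetric under the swap). (For jointly holomorphic `F k` the two mixed rows coincide — Schwarz; not needed and not claimed here.) -/
theorem derivMixed_step_rateω_swap (hs₁ : 0 < s₁) (hs₁ρ : s₁ * Real.cosh 1 < ρ)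
    (hF : ∀ k, DifferentiableOn ℂ (F k) (ball (0 : ℂ) ρ ×ˢ ball (0 : ℂ) ρ))
    (hB : ∀ k, ∀ p ∈ ball (0 : ℂ) ρ ×ˢ ball (0 : ℂ) ρ, ‖F k p‖ ≤ B) (hB0 : 0 < B)
    (hrate : ∀ k (s t : ℝ), 0 ≤ s → s ≤ s₁ → 0 ≤ t → t ≤ s₁ →
      ‖F (k + 1) ((s : ℂ), (t : ℂ)) - F k ((s : ℂ), (t : ℂ))‖ ≤ c * θ ^ k)
    (hc : 0 < c) (hθ : 0 < θ) {r r' : ℝ} (hr : 0 < r) (hr1 : r ≤ 1) (hr' : 0 < r') (hr'1 : r' ≤ 1) (k : ℕ) :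
    ‖deriv (fun s : ℂ => deriv (fun t : ℂ => F (k + 1) (s, t)) 0) 0
        - deriv (fun s : ℂ => deriv (fun t : ℂ => F k (s, t)) 0) 0‖ ≤
      25 * (2 * (4 * B / ρ)) ^ r' / (s₁ * r' ^ 2) * (25 * (2 * B) ^ r / (s₁ * r ^ 2) * c ^ (1 - r)) ^ (1 - r')
        * ((θ ^ (1 - r)) ^ (1 - r')) ^ k :=
  derivMixed_step_rateω (F := fun k p => F k (p.2, p.1)) hs₁ hs₁ρ (fun k => differentiableOn_swap (hF k))
    (fun k p hp => hB k (p.2, p.1) ⟨hp.2, hp.1⟩) hB0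
    (fun k s t hs0 hs1 ht0 ht1 => hrate k t s ht0 ht1 hs0 hs1) hc hθ hr hr1 hr' hr'1 k

/-- **`deriv_fst_step_rateω` — THE FIRST-ORDER ROW `∂_sF(0,0)` OF THE TWO-BOND FAMILY** [our proof]: `dslice_step_rate` at `t = 0`
(exponent `θ^{1−r}`; PART 7's one-parameter theorem on the `s`-slice through the base point). -/
theorem deriv_fst_step_rateω (hs₁ : 0 < s₁) (hs₁ρ : s₁ * Real.cosh 1 < ρ)
    (hF : ∀ k, DifferentiableOn ℂ (F k) (ball (0 : ℂ) ρ ×ˢ ball (0 : ℂ) ρ))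
    (hB : ∀ k, ∀ p ∈ ball (0 : ℂ) ρ ×ˢ ball (0 : ℂ) ρ, ‖F k p‖ ≤ B)
    (hrate : ∀ k (s t : ℝ), 0 ≤ s → s ≤ s₁ → 0 ≤ t → t ≤ s₁ →
      ‖F (k + 1) ((s : ℂ), (t : ℂ)) - F k ((s : ℂ), (t : ℂ))‖ ≤ c * θ ^ k)
    (hc : 0 < c) (hθ : 0 < θ) {r : ℝ} (hr : 0 < r) (hr1 : r ≤ 1) (k : ℕ) :
    ‖deriv (fun s : ℂ => F (k + 1) (s, 0)) 0 - deriv (fun s : ℂ => F k (s, 0)) 0‖ ≤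
      25 * (2 * B) ^ r / (s₁ * r ^ 2) * c ^ (1 - r) * (θ ^ (1 - r)) ^ k := by
  have key := dslice_step_rate hs₁ hs₁ρ hF hB hrate hc hθ hr hr1 k (t := 0) le_rfl hs₁.le
  simpa using key

/-- **`deriv_snd_step_rateω` — THE FIRST-ORDER ROW `∂_tF(0,0)`** [our proof]: the swap of `deriv_fst_step_rateω`. -/
theorem deriv_snd_step_rateω (hs₁ : 0 < s₁) (hs₁ρ : s₁ * Real.cosh 1 < ρ)
    (hF : ∀ k, DifferentiableOn ℂ (F k) (ball (0 : ℂ) ρ ×ˢ ball (0 : ℂ) ρ))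
    (hB : ∀ k, ∀ p ∈ ball (0 : ℂ) ρ ×ˢ ball (0 : ℂ) ρ, ‖F k p‖ ≤ B)
    (hrate : ∀ k (s t : ℝ), 0 ≤ s → s ≤ s₁ → 0 ≤ t → t ≤ s₁ →
      ‖F (k + 1) ((s : ℂ), (t : ℂ)) - F k ((s : ℂ), (t : ℂ))‖ ≤ c * θ ^ k)
    (hc : 0 < c) (hθ : 0 < θ) {r : ℝ} (hr : 0 < r) (hr1 : r ≤ 1) (k : ℕ) :
    ‖deriv (fun t : ℂ => F (k + 1) (0, t)) 0 - deriv (fun t : ℂ => F k (0, t)) 0‖ ≤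
      25 * (2 * B) ^ r / (s₁ * r ^ 2) * c ^ (1 - r) * (θ ^ (1 - r)) ^ k :=
  deriv_fst_step_rateω (F := fun k p => F k (p.2, p.1)) hs₁ hs₁ρ (fun k => differentiableOn_swap (hF k))
    (fun k p hp => hB k (p.2, p.1) ⟨hp.2, hp.1⟩)
    (fun k s t hs0 hs1 ht0 ht1 => hrate k t s ht0 ht1 hs0 hs1) hc hθ hr hr1 k

/-- **`exists_secondOrderJet_geometricRate` — JOINT ∃θ END FOR THE TWO-BOND FAMILY'S POLARISATION ROWS** [our proof]: under the hypotheses of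
`derivMixed_step_rateω` (with `θ < 1`) there is ONE pair `(c″, θ″)`, `0 ≤ c″`, `0 ≤ θ″ < 1`, such that for every `k` the four rows at the
base point — first order `∂_s`, `∂_t` and mixed `∂_t∂_s`, `∂_s∂_t` — of `F (k+1) − F k` are ALL `≤ c″·θ″^k` (witness `θ″ = (θ^{1∕2})^{1∕2}`,
which dominates the first-order rows' `θ^{1∕2}`; the pure rows `∂_s²`, `∂_t²` are PART 7 §4 on the two slices and are not repeated). -/
theorem exists_secondOrderJet_geometricRate (hs₁ : 0 < s₁) (hs₁ρ : s₁ * Real.cosh 1 < ρ)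
    (hF : ∀ k, DifferentiableOn ℂ (F k) (ball (0 : ℂ) ρ ×ˢ ball (0 : ℂ) ρ))
    (hB : ∀ k, ∀ p ∈ ball (0 : ℂ) ρ ×ˢ ball (0 : ℂ) ρ, ‖F k p‖ ≤ B) (hB0 : 0 < B)
    (hrate : ∀ k (s t : ℝ), 0 ≤ s → s ≤ s₁ → 0 ≤ t → t ≤ s₁ →
      ‖F (k + 1) ((s : ℂ), (t : ℂ)) - F k ((s : ℂ), (t : ℂ))‖ ≤ c * θ ^ k)
    (hc : 0 < c) (hθ : 0 < θ) (hθ1 : θ < 1) :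
    ∃ c'' θ'' : ℝ, 0 ≤ c'' ∧ 0 ≤ θ'' ∧ θ'' < 1 ∧ ∀ k,
      ‖deriv (fun s : ℂ => F (k + 1) (s, 0)) 0 - deriv (fun s : ℂ => F k (s, 0)) 0‖ ≤ c'' * θ'' ^ k ∧
      ‖deriv (fun t : ℂ => F (k + 1) (0, t)) 0 - deriv (fun t : ℂ => F k (0, t)) 0‖ ≤ c'' * θ'' ^ k ∧
      ‖deriv (fun t : ℂ => deriv (fun s : ℂ => F (k + 1) (s, t)) 0) 0
          - deriv (fun t : ℂ => deriv (fun s : ℂ => F k (s, t)) 0) 0‖ ≤ c'' * θ'' ^ k ∧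
      ‖deriv (fun s : ℂ => deriv (fun t : ℂ => F (k + 1) (s, t)) 0) 0
          - deriv (fun s : ℂ => deriv (fun t : ℂ => F k (s, t)) 0) 0‖ ≤ c'' * θ'' ^ k := by
  have hρ : 0 < ρ := rho_pos hs₁ hs₁ρ
  -- the two constants: `A` for the first-order rows (exponent `θ₁ := θ^{1∕2}`), `M` for the mixed rows (exponent `θ₂ := θ₁^{1∕2}`)
  set A : ℝ := 25 * (2 * B) ^ (1 / 2 : ℝ) / (s₁ * (1 / 2 : ℝ) ^ 2) * c ^ (1 - 1 / 2 : ℝ) with hA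
  set M : ℝ := 25 * (2 * (4 * B / ρ)) ^ (1 / 2 : ℝ) / (s₁ * (1 / 2 : ℝ) ^ 2) * A ^ (1 - 1 / 2 : ℝ) with hM
  set θ₁ : ℝ := θ ^ (1 - 1 / 2 : ℝ) with hθ₁
  set θ₂ : ℝ := θ₁ ^ (1 - 1 / 2 : ℝ) with hθ₂
  have hA0 : 0 < A := const₁_pos hs₁ hB0 hc (by norm_num : (0 : ℝ) < 1 / 2)
  have hM0 : 0 ≤ M := by
    have h1 : 0 ≤ (2 * (4 * B / ρ)) ^ (1 / 2 : ℝ) := Real.rpow_nonneg (by positivity) _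
    have h2 : 0 ≤ A ^ (1 - 1 / 2 : ℝ) := Real.rpow_nonneg hA0.le _
    rw [hM]; positivity
  have hθ₁0 : 0 ≤ θ₁ := Real.rpow_nonneg hθ.le _
  have hθ₁1 : θ₁ < 1 := Real.rpow_lt_one hθ.le hθ1 (by norm_num)
  have hθ₂0 : 0 ≤ θ₂ := Real.rpow_nonneg hθ₁0 _
  have hθ₂1 : θ₂ < 1 := Real.rpow_lt_one hθ₁0 hθ₁1 (by norm_num)
  -- `θ₁ ≤ θ₂` (raising a number in `[0,1]` to the power `1∕2` does not decrease it)
  have hθ₁₂ : θ₁ ≤ θ₂ := by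
    rw [hθ₂]
    exact Real.self_le_rpow_of_le_one hθ₁0 hθ₁1.le (by norm_num)
  refine ⟨max A M, θ₂, le_max_of_le_left hA0.le, hθ₂0, hθ₂1, fun k => ⟨?_, ?_, ?_, ?_⟩⟩
  · calc _ ≤ A * θ₁ ^ k := deriv_fst_step_rateω hs₁ hs₁ρ hF hB hrate hc hθ (by norm_num) (by norm_num) k
      _ ≤ max A M * θ₂ ^ k := by gcongr; exact le_max_left _ _
  · calc _ ≤ A * θ₁ ^ k := deriv_snd_step_rateω hs₁ hs₁ρ hF hB hrate hc hθ (by norm_num) (by norm_num) k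
      _ ≤ max A M * θ₂ ^ k := by gcongr; exact le_max_left _ _
  · have h3 := derivMixed_step_rateω hs₁ hs₁ρ hF hB hB0 hrate hc hθ (r := 1 / 2) (r' := 1 / 2)
      (by norm_num) (by norm_num) (by norm_num) (by norm_num) k
    calc _ ≤ M * θ₂ ^ k := h3
      _ ≤ max A M * θ₂ ^ k := by gcongr; exact le_max_right _ _
  · have h4 := derivMixed_step_rateω_swap hs₁ hs₁ρ hF hB hB0 hrate hc hθ (r := 1 / 2) (r' := 1 / 2)
      (by norm_num) (by norm_num) (by norm_num) (by norm_num) k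
    calc _ ≤ M * θ₂ ^ k := h4
      _ ≤ max A M * θ₂ ^ k := by gcongr; exact le_max_right _ _

end Joint

end Summit.QuantumFields.BalabanUV.Beta.GAN24.DerivativeRateTransferAnalyticMixed

end
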